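import Literature.Topology.FourManifolds.CircleNbhdOfFraming
import HarnessLib

/-!
# Framed tube maps: a partial diffeomorphism `M × B(0, ε) ⇀ X` around a framed embedded submanifold

Topic `Literature/Topology/FourManifolds`; infrastructure for the named fact
`Literature.Geometry.Symplectic.exists_handleAttachingMap_of_isKnotFraming` (`TwoHandleIsotopy.lean`),
which needs a tubular neighbourhood of a knot *in the 3-manifold `∂W`* with control of its fibre
derivative along the zero section.  The tree's `CircleNbhdOfFraming.lean` proves, in dimension
`4` and with the derivative information discarded, that a normal framing of an embedded circle
yields a tubular neighbourhood (`nonempty_circleNbhd_of_isSmoothAlong`).  This file records the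
same argument **in all dimensions and codimensions, keeping the tube unsqueezed and its fibre
derivative**:

* `mfderiv_framedTube_zero` — the differential at the zero section of a tube map with fibre
  derivative `N x` is `(dc_x) ⊕ N x` (general form of `mfderiv_tube_zero`);
* `nhds_le_map_of_isLocalDiffeomorphAt`, `isOpenMap_restrict_of_nhds_le` — a map which is a local
  diffeomorphism at the points of an open set restricts to an open map there;
* `exists_framedTube` — for a `C^∞` injective `c : M → X` from a compact manifold into a manifold
  charted on its model vector space `E`, and linear maps `N x : F →L E = T_{c x} X` smooth along
  `c` (`IsSmoothAlong`) with `(dc_x) ⊕ N x` bijective (a framing of the normal bundle), there are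
  `ε > 0` and an open partial homeomorphism `Φ : M × F ⇀ X` with source `M × B(0, ε)`, `C^∞` with
  `C^∞` inverse (a partial diffeomorphism onto an open set of `X`), restricting to `c` on the zero
  section and with fibre derivative `N x` there (read in the chart at `c x`).  Proof as in
  Kosinski, *Differential Manifolds* (1993), III, Thm. 2.2 / Hirsch, *Differential Topology*
  (1976), Ch. 4 §5, Thm. 5.1: the tube map of `exists_tube_of_isSmoothAlong`
  (`TubeFromFraming.lean`) has invertible differential along the zero section, hence is a local
  diffeomorphism on a uniform tube (inverse function theorem on manifolds,
  `isLocalDiffeomorphAt_of_mfderiv`, and compactness), and it is injective on a smaller tube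
  (`exists_injOn_prod_ball_of_continuousAt`).

Everything here is proved; no named facts are introduced.

## References

* A. A. Kosinski, *Differential Manifolds* (1993), III, Thm. 2.2, Cor. 2.3. [Kosinski1993]
* M. W. Hirsch, *Differential Topology*, GTM 33 (1976), Ch. 4 §5, Thm. 5.1. [HirschDT1976]
-/

open scoped Manifold ContDiff Topology
open Set Function Filter Metric

noncomputable section

namespace Literature.Topology.FourManifolds

/-! ### Local diffeomorphisms at the points of an open set restrict to open maps -/

section OpenMap

variable {E : Type*} [NormedAddCommGroup E] [NormedSpace ℝ E] {H : Type*} [TopologicalSpace H]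
  {I : ModelWithCorners ℝ E H} {M : Type*} [TopologicalSpace M] [ChartedSpace H M]
  {E' : Type*} [NormedAddCommGroup E'] [NormedSpace ℝ E'] {H' : Type*} [TopologicalSpace H']
  {J : ModelWithCorners ℝ E' H'} {N : Type*} [TopologicalSpace N] [ChartedSpace H' N] {n : ℕ∞ω}

/-- A local diffeomorphism at `x` maps neighbourhoods of `x` onto neighbourhoods of `f x`.
[folklore] -/
theorem nhds_le_map_of_isLocalDiffeomorphAt {f : M → N} {x : M}
    (hf : IsLocalDiffeomorphAt I J n f x) : 𝓝 (f x) ≤ map f (𝓝 x) := by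
  have hg : ContinuousAt hf.localInverse (f x) := hf.localInverse_contMDiffAt.continuousAt
  have hgx : hf.localInverse (f x) = x := hf.localInverse_left_inv hf.localInverse_mem_target
  have h1 : map hf.localInverse (𝓝 (f x)) ≤ 𝓝 x := by
    have := hg.tendsto
    rwa [hgx] at this
  calc 𝓝 (f x) = map id (𝓝 (f x)) := (map_id).symm
    _ = map (f ∘ hf.localInverse) (𝓝 (f x)) := (map_congr hf.localInverse_eventuallyEq_right).symm
    _ = map f (map hf.localInverse (𝓝 (f x))) := (map_map).symm
    _ ≤ map f (𝓝 x) := map_mono h1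

omit [ChartedSpace H M] [ChartedSpace H' N] in
/-- A map sending neighbourhoods of the points of an open set `s` to neighbourhoods of their
images restricts to an open map on `s`. [folklore] -/
theorem isOpenMap_restrict_of_nhds_le {f : M → N} {s : Set M} (hs : IsOpen s)
    (h : ∀ x ∈ s, 𝓝 (f x) ≤ map f (𝓝 x)) : IsOpenMap (s.restrict f) := by
  rw [isOpenMap_iff_nhds_le]
  intro x
  calc 𝓝 (s.restrict f x) = 𝓝 (f x) := rfl
    _ ≤ map f (𝓝 (x : M)) := h x x.2
    _ = map f (𝓝[s] (x : M)) := by rw [hs.nhdsWithin_eq x.2]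
    _ = map f (map ((↑) : s → M) (𝓝 x)) := by rw [map_nhds_subtype_val]
    _ = map (s.restrict f) (𝓝 x) := map_map

end OpenMap

/-! ### The differential of a tube map at the zero section -/

section Tube

variable {EM : Type*} [NormedAddCommGroup EM] [NormedSpace ℝ EM] {HM : Type*}
  [TopologicalSpace HM] {IM : ModelWithCorners ℝ EM HM} {M : Type*} [TopologicalSpace M]
  [ChartedSpace HM M]
  {E : Type*} [NormedAddCommGroup E] [NormedSpace ℝ E] {X : Type*} [TopologicalSpace X]
  [ChartedSpace E X]
  {F : Type*} [NormedAddCommGroup F] [NormedSpace ℝ F]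

/-- **The differential of a tube map at the zero section** (general form of the tree's
`mfderiv_tube_zero`): if `G : M × F → X` is `C^∞` on an open neighbourhood of the zero section,
restricts to `c` on it, and its fibre derivative at `(x, 0)` read in the chart at `c x` is `N x`,
then `mfderiv G (x, 0) = (mfderiv c x).coprod (N x)`. [folklore] -/
theorem mfderiv_framedTube_zero {c : M → X} {N : M → F →L[ℝ] E} {G : M × F → X}
    {W : Set (M × F)} (hWo : IsOpen W) (hW0 : ∀ x, (x, (0 : F)) ∈ W)
    (hGW : ContMDiffOn (IM.prod 𝓘(ℝ, F)) 𝓘(ℝ, E) ∞ G W) (hG0 : ∀ x, G (x, 0) = c x)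
    (hGd : ∀ x, HasFDerivAt (fun v : F => extChartAt 𝓘(ℝ, E) (c x) (G (x, v))) (N x) 0)
    (x : M) :
    mfderiv (IM.prod 𝓘(ℝ, F)) 𝓘(ℝ, E) G (x, 0) = (mfderiv IM 𝓘(ℝ, E) c x).coprod (N x) := by
  have hGat : ContMDiffAt (IM.prod 𝓘(ℝ, F)) 𝓘(ℝ, E) ∞ G (x, 0) :=
    hGW.contMDiffAt (hWo.mem_nhds (hW0 x))
  have hdiff : MDifferentiableAt (IM.prod 𝓘(ℝ, F)) 𝓘(ℝ, E) G (x, 0) :=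
    hGat.mdifferentiableAt (by simp)
  have hfib : HasMFDerivAt 𝓘(ℝ, F) 𝓘(ℝ, E) (fun v : F => G (x, v)) 0 (N x) := by
    refine ⟨?_, ?_⟩
    · exact hGat.continuousAt.comp (by fun_prop)
    · have h1 : writtenInExtChartAt 𝓘(ℝ, F) 𝓘(ℝ, E) 0 (fun v : F => G (x, v)) =
          fun v : F => extChartAt 𝓘(ℝ, E) (c x) (G (x, v)) := by
        ext v
        simp only [writtenInExtChartAt, hG0, extChartAt_model_space_eq_id, PartialEquiv.refl_symm,
          PartialEquiv.refl_coe, comp_apply, id_eq]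
      rw [h1, modelWithCornersSelf_coe, range_id, hasFDerivWithinAt_univ,
        extChartAt_model_space_eq_id, PartialEquiv.refl_coe, id_eq]
      exact hGd x
  have hc' : (fun z : M => G (z, 0)) = c := funext hG0
  ext1 v
  rw [mfderiv_prod_eq_add_apply hdiff, hc', hfib.mfderiv]
  rfl

variable [T2Space M] [CompactSpace M] [FiniteDimensional ℝ EM] [IsManifold IM ∞ M]
  [IM.Boundaryless] [T2Space X] [IsManifold 𝓘(ℝ, E) ∞ X]
  [FiniteDimensional ℝ F]

/-- **The framed tube of a normally framed compact submanifold** (Kosinski, *Differential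
Manifolds* (1993), III, Thm. 2.2; Hirsch (1976), Ch. 4 §5, Thm. 5.1).  Let `c : M → X` be a
`C^∞` injective map from a compact manifold into a `C^∞` manifold charted on the vector space `E`,
and `N x : F →L E = T_{c x} X` linear maps smooth along `c` such that `(dc_x) ⊕ N x` is bijective
for every `x` (so `c` is an immersion and `N` frames its normal bundle).  Then for some `ε > 0`
there is an open partial homeomorphism `Φ : M × F ⇀ X` with source the tube `M × B(0, ε)`, `C^∞`
on its source with `C^∞` inverse on its (open) target — a diffeomorphism of the tube onto an open
neighbourhood of `c(M)` —, which restricts to `c` on the zero section and whose fibre derivative at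
`(x, 0)`, read in the chart of `X` at `c x`, is `N x`.  The tube map of
`exists_tube_of_isSmoothAlong` has differential `(dc_x) ⊕ N x` along the zero section
(`mfderiv_framedTube_zero`), is therefore a local diffeomorphism on a uniform tube (inverse
function theorem `isLocalDiffeomorphAt_of_mfderiv`, compactness), injective on a smaller tube
(`exists_injOn_prod_ball_of_continuousAt`), hence a homeomorphism of that tube onto an open set,
with smooth local inverses. [cite: Kosinski1993, III Thm. 2.2] -/
theorem exists_framedTube [Nonempty M] {c : M → X} (hc : ContMDiff IM 𝓘(ℝ, E) ∞ c)
    (hinj : Injective c) {N : M → F →L[ℝ] E} (hN : IsSmoothAlong IM c N)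
    (hbij : ∀ x, Bijective ((mfderiv IM 𝓘(ℝ, E) c x).coprod (N x))) :
    ∃ (Φ : OpenPartialHomeomorph (M × F) X) (ε : ℝ), 0 < ε ∧
      Φ.source = (univ : Set M) ×ˢ ball (0 : F) ε ∧
      ContMDiffOn (IM.prod 𝓘(ℝ, F)) 𝓘(ℝ, E) ∞ Φ Φ.source ∧
      ContMDiffOn 𝓘(ℝ, E) (IM.prod 𝓘(ℝ, F)) ∞ Φ.symm Φ.target ∧
      (∀ x, Φ (x, 0) = c x) ∧
      ∀ x, HasFDerivAt (fun v : F => extChartAt 𝓘(ℝ, E) (c x) (Φ (x, v))) (N x) 0 := by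
  -- the tube map
  obtain ⟨G, ⟨W, hWo, hW0, hGW⟩, hG0, hGd⟩ :=
    exists_tube_of_isSmoothAlong (IM := IM) (F := F) hc hN
  have hGd' : ∀ x, HasFDerivAt (fun v : F => extChartAt 𝓘(ℝ, E) (c x) (G (x, v))) (N x) 0 :=
    fun x => by simpa only [frameIn_self] using hGd x (c x) (mem_chart_source _ (c x))
  -- local diffeomorphism at the zero section
  have hloc0 : ∀ x : M, IsLocalDiffeomorphAt (IM.prod 𝓘(ℝ, F)) 𝓘(ℝ, E) ∞ G (x, 0) := by
    intro x
    let L₀ : (EM × F) →ₗ[ℝ] E :=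
      show (EM × F) →ₗ[ℝ] E from ((mfderiv IM 𝓘(ℝ, E) c x).coprod (N x)).toLinearMap
    have hb : Bijective L₀ := by exact hbij x
    let L : (EM × F) ≃L[ℝ] E := (LinearEquiv.ofBijective L₀ hb).toContinuousLinearEquiv
    refine isLocalDiffeomorphAt_of_mfderiv hWo (hW0 x) hGW (by simp) L ?_
    rw [mfderiv_framedTube_zero hWo hW0 hGW hG0 hGd' x]
    rfl
  -- a uniform tube of local diffeomorphisms
  obtain ⟨ε₁, hε₁, hloc⟩ : ∃ ε₁ > 0, ∀ q : M × F, q.2 ∈ ball (0 : F) ε₁ →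
      IsLocalDiffeomorphAt (IM.prod 𝓘(ℝ, F)) 𝓘(ℝ, E) ∞ G q := by
    have hopen := isOpen_setOf_isLocalDiffeomorphAt (I := IM.prod 𝓘(ℝ, F)) (J := 𝓘(ℝ, E))
      (n := ∞) G
    have hsub : (univ : Set M) ×ˢ ({0} : Set F) ⊆
        {q | IsLocalDiffeomorphAt (IM.prod 𝓘(ℝ, F)) 𝓘(ℝ, E) ∞ G q} := by
      rintro ⟨x, v⟩ ⟨-, hv⟩
      rw [mem_singleton_iff] at hv
      subst hv
      exact hloc0 x
    obtain ⟨U, V, -, hV, hU, h0V, hUV⟩ :=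
      generalized_tube_lemma isCompact_univ isCompact_singleton hopen hsub
    obtain ⟨ε, hε, hball⟩ := Metric.isOpen_iff.1 hV 0 (h0V rfl)
    exact ⟨ε, hε, fun q hq => hUV ⟨hU (mem_univ _), hball hq⟩⟩
  -- injectivity on a uniform tube
  obtain ⟨ε₂, hε₂, hinjOn⟩ : ∃ ε₂ > 0, InjOn G ((univ : Set M) ×ˢ ball (0 : F) ε₂) := by
    refine exists_injOn_prod_ball_of_continuousAt (fun x => ?_) ?_ fun x => ?_
    · exact (hGW.contMDiffAt (hWo.mem_nhds (hW0 x))).continuousAt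
    · intro x y hxy
      simp only [hG0] at hxy
      exact hinj hxy
    · obtain ⟨Ψ, hx, heq⟩ := hloc0 x
      exact ⟨Ψ.source, Ψ.open_source.mem_nhds hx, fun a ha b hb hab =>
        Ψ.injOn ha hb (by rwa [← heq ha, ← heq hb])⟩
  -- the tube of radius `ε = min ε₁ ε₂`
  set ε : ℝ := min ε₁ ε₂ with hε_def
  have hε : 0 < ε := lt_min hε₁ hε₂
  set O : Set (M × F) := (univ : Set M) ×ˢ ball (0 : F) ε with hO_def
  have hOo : IsOpen O := isOpen_univ.prod isOpen_ball
  have hO₁ : ∀ q ∈ O, IsLocalDiffeomorphAt (IM.prod 𝓘(ℝ, F)) 𝓘(ℝ, E) ∞ G q := fun q hq =>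
    hloc q (ball_subset_ball (min_le_left _ _) hq.2)
  have hinjO : InjOn G O := hinjOn.mono (prod_mono Subset.rfl (ball_subset_ball (min_le_right _ _)))
  have hGO : ContMDiffOn (IM.prod 𝓘(ℝ, F)) 𝓘(ℝ, E) ∞ G O := fun q hq =>
    (hO₁ q hq).contMDiffAt.contMDiffWithinAt
  -- the partial equivalence and the open partial homeomorphism
  set e : PartialEquiv (M × F) X := hinjO.toPartialEquiv G O with he_def
  have he_coe : (e : M × F → X) = G := rfl
  have he_source : e.source = O := rfl
  have hopen : IsOpenMap (e.source.restrict e) := by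
    rw [he_source, he_coe]
    exact isOpenMap_restrict_of_nhds_le hOo fun q hq => nhds_le_map_of_isLocalDiffeomorphAt (hO₁ q hq)
  set Φ : OpenPartialHomeomorph (M × F) X :=
    OpenPartialHomeomorph.ofContinuousOpenRestrict e (by rw [he_source, he_coe]; exact hGO.continuousOn)
      hopen (by rw [he_source]; exact hOo) with hΦ_def
  have hΦ_coe : (Φ : M × F → X) = G := rfl
  have hΦ_source : Φ.source = O := rfl
  refine ⟨Φ, ε, hε, hΦ_source, by rw [hΦ_coe, hΦ_source]; exact hGO, ?_, fun x => ?_, ?_⟩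
  · -- the inverse is smooth: near each point it is a local inverse of `G`
    rintro y hy
    obtain ⟨q, hq, rfl⟩ : y ∈ G '' O := by
      rw [← he_coe, ← he_source, e.image_source_eq_target]; exact hy
    have hld := hO₁ q hq
    apply ContMDiffAt.contMDiffWithinAt
    -- points near `G q` are images of points of `O ∩ (local inverse target)`
    have hT : O ∩ hld.localInverse.target ∈ 𝓝 q :=
      inter_mem (hOo.mem_nhds hq) (hld.localInverse.open_target.mem_nhds hld.localInverse_mem_target)
    have himg : G '' (O ∩ hld.localInverse.target) ∈ 𝓝 (G q) :=
      nhds_le_map_of_isLocalDiffeomorphAt hld (image_mem_map hT)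
    have hev : (Φ.symm : X → M × F) =ᶠ[𝓝 (G q)] hld.localInverse := by
      filter_upwards [himg] with _ hy'
      obtain ⟨q', ⟨hq'O, hq'T⟩, rfl⟩ := hy'
      rw [hld.localInverse_left_inv hq'T]
      exact Φ.left_inv (show q' ∈ Φ.source from hq'O)
    exact hld.localInverse_contMDiffAt.congr_of_eventuallyEq hev
  · show G (x, 0) = c x
    exact hG0 x
  · intro x
    show HasFDerivAt (fun v : F => extChartAt 𝓘(ℝ, E) (c x) (G (x, v))) (N x) 0
    exact hGd' x

end Tube

end Literature.Topology.FourManifolds
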